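import Summits.AtomisticToContinuum.FouriersLaw.Theorems.OddSectorIrreversibilityResponseDensityConfining
import Summits.AtomisticToContinuum.FouriersLaw.Theorems.OddSectorIrreversibilityResponseDensityGibbsCutoff
import Literature.MathematicalPhysics.KineticTheory.LangevinChainDynkin
import Literature.MathematicalPhysics.KineticTheory.LangevinChainGibbs

/-!
# Gibbs-weighted pairings of the transition kernels of the pinned chain: integrability and truncation

Helper file for item stmt-AtomisticToContinuum-9144 (`ResponseDensity`, route
`OddSectorIrreversibility`, sub-problem `FouriersLaw` of `AtomisticToContinuum`).

For the transition kernels `P_t` of `pinnedChain ω₂ lam β γ` between baths at `T_L, T_R > 0`, an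
exponent `0 < ϑ < 1/max(T_L,T_R)` and an observable `φ` with `|φ| ≤ C e^{ϑH}`:
`P_t|φ|(x) ≤ C e^{ϑγ(T_L+T_R)t} e^{ϑH(x)}` (CEHR (3.4)), the truncations `χ(H/R) φ` have
`P_t(χ(H/R)φ) → P_t φ` pointwise as `R → ∞`, and the Gibbs-weighted pairings
`∫ e^{θH} P_t φ dx` (`θ + ϑ < 0`) are absolutely convergent. These are the dominated-convergence
inputs of the exact response identity (`…ResponseDensityBackward.lean`). No definitions.
-/

noncomputable section

open MeasureTheory ProbabilityTheory Filter Topology Set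
open scoped NNReal ENNReal ContDiff

namespace Summit.AtomisticToContinuum.FouriersLaw.Theorems

open Literature.MathematicalPhysics.KineticTheory.HeatConduction
open Literature.Probability.Process Literature.MathematicalPhysics.KineticTheory OscillatorChain

variable {N : ℕ}

section Kernel

variable {ω₂ lam β γ : ℝ} (hω : 0 < ω₂) (hl : 0 ≤ lam) (hβ : 0 ≤ β) (hγ : 0 < γ)
  (hN : 0 < N) {T_L T_R : ℝ} (hTL : 0 < T_L) (hTR : 0 < T_R)
  {ϑ : ℝ} (hϑ : 0 < ϑ) (hϑ' : ϑ < 1 / max T_L T_R)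
include hω hl hβ hγ hN hTL hTR hϑ hϑ'

/-- CEHR (3.4) for the transition kernels: `∫ e^{ϑH} dP_t(x,·) ≤ e^{ϑγ(T_L+T_R)t} e^{ϑH(x)}`
(Lebesgue-integral form). -/
theorem pinnedChain_lintegral_exp_kernel_le (t : ℝ≥0) (x : PhaseSpace N) :
    ∫⁻ y, ENNReal.ofReal (Real.exp (ϑ * (pinnedChain ω₂ lam β γ).hamiltonian N y))
        ∂((pinnedChain ω₂ lam β γ).transitionKernel N T_L T_R t x) ≤
      ENNReal.ofReal (Real.exp (ϑ * γ * (T_L + T_R) * t) *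
        Real.exp (ϑ * (pinnedChain ω₂ lam β γ).hamiltonian N x)) :=
  lintegral_exp_mul_hamiltonian_pinnedChainSemigroup_le hω hl hβ hγ.le hN hTL.le hTR.le hTL hTR
    hϑ hϑ' t x

/-- `e^{ϑH}` is integrable for every transition probability `P_t(x, ·)`. -/
theorem pinnedChain_integrable_exp_kernel (t : ℝ≥0) (x : PhaseSpace N) :
    Integrable (fun y => Real.exp (ϑ * (pinnedChain ω₂ lam β γ).hamiltonian N y))
      ((pinnedChain ω₂ lam β γ).transitionKernel N T_L T_R t x) := by
  have hc : Continuous fun y => Real.exp (ϑ * (pinnedChain ω₂ lam β γ).hamiltonian N y) :=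
    Real.continuous_exp.comp (continuous_const.mul
      ((pinnedChain_contDiff_hamiltonian ω₂ lam β γ N (n := 0)).continuous))
  refine ⟨hc.aestronglyMeasurable, ?_⟩
  have h := pinnedChain_lintegral_exp_kernel_le hω hl hβ hγ hN hTL hTR hϑ hϑ' t x
  refine lt_of_le_of_lt ?_ (lt_of_le_of_lt h ENNReal.ofReal_lt_top)
  refine lintegral_mono fun y => ?_
  rw [Real.enorm_eq_ofReal (Real.exp_pos _).le]

/-- `∫ e^{ϑH} dP_t(x,·) ≤ e^{ϑγ(T_L+T_R)t} e^{ϑH(x)}` (Bochner form). -/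
theorem pinnedChain_integral_exp_kernel_le (t : ℝ≥0) (x : PhaseSpace N) :
    ∫ y, Real.exp (ϑ * (pinnedChain ω₂ lam β γ).hamiltonian N y)
        ∂((pinnedChain ω₂ lam β γ).transitionKernel N T_L T_R t x) ≤
      Real.exp (ϑ * γ * (T_L + T_R) * t) * Real.exp (ϑ * (pinnedChain ω₂ lam β γ).hamiltonian N x) := by
  rw [integral_eq_lintegral_of_nonneg_ae (Eventually.of_forall fun y => (Real.exp_pos _).le)
    (pinnedChain_integrable_exp_kernel hω hl hβ hγ hN hTL hTR hϑ hϑ' t x).aestronglyMeasurable]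
  have h := pinnedChain_lintegral_exp_kernel_le hω hl hβ hγ hN hTL hTR hϑ hϑ' t x
  have hfin : ∫⁻ y, ENNReal.ofReal (Real.exp (ϑ * (pinnedChain ω₂ lam β γ).hamiltonian N y))
      ∂((pinnedChain ω₂ lam β γ).transitionKernel N T_L T_R t x) ≠ ⊤ :=
    ne_top_of_le_ne_top ENNReal.ofReal_ne_top h
  have := (ENNReal.toReal_le_toReal hfin ENNReal.ofReal_ne_top).2 h
  rwa [ENNReal.toReal_ofReal (by positivity)] at this

variable {φ : PhaseSpace N → ℝ} (hφc : Continuous φ) {C : ℝ}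
  (hφ : ∀ y, |φ y| ≤ C * Real.exp (ϑ * (pinnedChain ω₂ lam β γ).hamiltonian N y))
include hφc hφ

/-- An observable dominated by `C e^{ϑH}` is integrable for every `P_t(x, ·)`. -/
theorem pinnedChain_integrable_kernel_of_abs_le (t : ℝ≥0) (x : PhaseSpace N) :
    Integrable φ ((pinnedChain ω₂ lam β γ).transitionKernel N T_L T_R t x) := by
  refine ((pinnedChain_integrable_exp_kernel hω hl hβ hγ hN hTL hTR hϑ hϑ' t x).const_mul C).mono'
    hφc.aestronglyMeasurable (Eventually.of_forall fun y => ?_)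
  rw [Real.norm_eq_abs]
  exact hφ y

omit hφc in
/-- **The weighted bound of the forecast**: for any `g` with `|g| ≤ 1`,
`|∫ g φ dP_t(x,·)| ≤ C e^{ϑγ(T_L+T_R)t} e^{ϑH(x)}`. -/
theorem pinnedChain_abs_integral_kernel_le (t : ℝ≥0) (x : PhaseSpace N) {g : PhaseSpace N → ℝ}
    (hg : ∀ y, |g y| ≤ 1) :
    |∫ y, g y * φ y ∂((pinnedChain ω₂ lam β γ).transitionKernel N T_L T_R t x)| ≤
      C * (Real.exp (ϑ * γ * (T_L + T_R) * t) *
        Real.exp (ϑ * (pinnedChain ω₂ lam β γ).hamiltonian N x)) := by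
  have hC : 0 ≤ C := by
    have := (abs_nonneg _).trans (hφ x)
    exact nonneg_of_mul_nonneg_left this (Real.exp_pos _)
  have hI := pinnedChain_integrable_exp_kernel hω hl hβ hγ hN hTL hTR hϑ hϑ' t x
  calc |∫ y, g y * φ y ∂((pinnedChain ω₂ lam β γ).transitionKernel N T_L T_R t x)|
      ≤ ∫ y, |g y * φ y| ∂((pinnedChain ω₂ lam β γ).transitionKernel N T_L T_R t x) :=
        abs_integral_le_integral_abs
    _ ≤ ∫ y, C * Real.exp (ϑ * (pinnedChain ω₂ lam β γ).hamiltonian N y)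
          ∂((pinnedChain ω₂ lam β γ).transitionKernel N T_L T_R t x) := by
        refine integral_mono_of_nonneg (Eventually.of_forall fun y => abs_nonneg _) (hI.const_mul C)
          (Eventually.of_forall fun y => ?_)
        show |g y * φ y| ≤ C * Real.exp (ϑ * (pinnedChain ω₂ lam β γ).hamiltonian N y)
        rw [abs_mul]
        calc |g y| * |φ y| ≤ 1 * |φ y| := mul_le_mul_of_nonneg_right (hg y) (abs_nonneg _)
          _ = |φ y| := one_mul _
          _ ≤ _ := hφ y
    _ = C * ∫ y, Real.exp (ϑ * (pinnedChain ω₂ lam β γ).hamiltonian N y)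
          ∂((pinnedChain ω₂ lam β γ).transitionKernel N T_L T_R t x) := integral_const_mul _ _
    _ ≤ _ := mul_le_mul_of_nonneg_left
        (pinnedChain_integral_exp_kernel_le hω hl hβ hγ hN hTL hTR hϑ hϑ' t x) hC

omit hφc in
/-- `|P_t φ(x)| ≤ C e^{ϑγ(T_L+T_R)t} e^{ϑH(x)}`. -/
theorem pinnedChain_abs_integral_kernel_le' (t : ℝ≥0) (x : PhaseSpace N) :
    |∫ y, φ y ∂((pinnedChain ω₂ lam β γ).transitionKernel N T_L T_R t x)| ≤
      C * (Real.exp (ϑ * γ * (T_L + T_R) * t) *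
        Real.exp (ϑ * (pinnedChain ω₂ lam β γ).hamiltonian N x)) := by
  have h := pinnedChain_abs_integral_kernel_le hω hl hβ hγ hN hTL hTR hϑ hϑ' hφ t x
    (g := fun _ => 1) (fun _ => by simp)
  simpa using h

/-- **Removing the truncation inside the forecast**: `P_t(χ(H/(n+1)) φ)(x) → P_t φ(x)` as
`n → ∞` (dominated convergence, majorant `|φ|`). -/
theorem pinnedChain_tendsto_integral_cutoff_kernel (t : ℝ≥0) (x : PhaseSpace N) :
    Tendsto (fun n : ℕ => ∫ y, smoothCutoff ((pinnedChain ω₂ lam β γ).hamiltonian N y / (n + 1)) * φ y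
        ∂((pinnedChain ω₂ lam β γ).transitionKernel N T_L T_R t x))
      atTop (𝓝 (∫ y, φ y ∂((pinnedChain ω₂ lam β γ).transitionKernel N T_L T_R t x))) := by
  have hHc : Continuous ((pinnedChain ω₂ lam β γ).hamiltonian N) :=
    (pinnedChain_contDiff_hamiltonian ω₂ lam β γ N (n := 0)).continuous
  have hsc : Continuous smoothCutoff := (contDiff_smoothCutoff (n := 0)).continuous
  have hI := pinnedChain_integrable_kernel_of_abs_le hω hl hβ hγ hN hTL hTR hϑ hϑ' hφc hφ t x
  refine tendsto_integral_of_dominated_convergence (fun y => |φ y|) (fun n => ?_) hI.abs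
    (fun n => Eventually.of_forall fun y => ?_) (Eventually.of_forall fun y => ?_)
  · exact ((hsc.comp (hHc.div_const _)).mul hφc).aestronglyMeasurable
  · rw [Real.norm_eq_abs, abs_mul]
    calc |smoothCutoff ((pinnedChain ω₂ lam β γ).hamiltonian N y / (n + 1))| * |φ y|
        ≤ 1 * |φ y| := by
          refine mul_le_mul_of_nonneg_right ?_ (abs_nonneg _)
          rw [abs_of_nonneg (smoothCutoff_nonneg _)]
          exact smoothCutoff_le_one _
      _ = |φ y| := one_mul _
  · refine tendsto_const_nhds.congr' ?_
    obtain ⟨n₀, hn₀⟩ := exists_nat_ge ((pinnedChain ω₂ lam β γ).hamiltonian N y)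
    filter_upwards [eventually_ge_atTop n₀] with n hn
    rw [smoothCutoff_of_le_one, one_mul]
    rw [div_le_one (by positivity)]
    calc (pinnedChain ω₂ lam β γ).hamiltonian N y ≤ n₀ := hn₀
      _ ≤ n := by exact_mod_cast hn
      _ ≤ n + 1 := by linarith

end Kernel

end Summit.AtomisticToContinuum.FouriersLaw.Theorems

end
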